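import Summits.QuantumFields.YangMills.Theorems.BalabanUVNodesN16UniformScalarMinimisers
import HarnessLib

/-!
# YM-DAG node N16 (NE3), the re-keyed N07 in-edge — THE SLOT KEY (T9ˢ) ∧ (T8) ON THE UNIFORM-CURVATURE SCALAR DATA, AT RANK ONE: every minimiser is (9)–(10)-regular on
# every slot cube at leaf-06's `torusVP ∕ lipGauge` letters (the Landau field is in `lipGauge` with radii `(|f|K, |f|, 0)` about every centre), and minimisers exist — the
# DischargeTest's `stub_reg910Slot` SHAPE with the datum ranging over `𝒟_unif`, in the `U(1)` model (file 7 of the g6 piece; closes the g6 series)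

Cell `pub-ymgap`, width seat `pub-ymgap-dag-n16-w2` (director-ym №197 ∕ HUMAN RULING D-0149), generation 6.  `--kind proof --supports stmt-QuantumFields-27366 --as helper`
(K3⁸, KEY MAP v2).  `bears_on: R4∕N16`, edge N07 → N16.  COUNT-NEUTRAL.

HONEST FRAMING.  The ABELIAN, RANK-ONE model (`[Unique n]`, i.e. `U(1)`-valued lattice fields) and the data family `𝒟_unif` (scalar-presented, uniform `(e₀,e₁)`-curvature) ONLY:
kernel bookkeeping over files 1–6 of this generation, leaf-06's `MinimalActionDictionary.torusVP` and n16-w1's `lipGauge` shape.  It is NOT [Balaban1985Variational] Theorem 1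
(non-abelian, general loose data) and does NOT close dag-n16-e's ∕ this seat's DischargeTest `stub_reg910Slot` (whose datum ranges over ALL of `sfClass 4 F.L Nper ε₁ 0` at
`MatA N`); no K3⁸ v6 stub is named or closed; N16 ∕ N07 NOT discharged; counts UNMOVED (typed 28∕28 · discharged 5∕27 · A 5∕28).  R4 closes the conditional finite-𝕋⁴ rung
`BalabanLadder.UV` only; NOT ℝ⁴ ∕ OS ∕ mass gap; the YM mass gap (Clay) is NOT proved by any of this.

WHAT IS PROVED ([folklore], 0 `sorry`, 0 `def`).  §1 ★ `lipGauge_landau` (every dimension `d+2`, every rank): the Landau field `U_{f,0,0}` is in n16-w1's (9)_{β₀=1} sup shape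
`lipGauge (d+2) n · y K (|f|·K) |f| 0` about EVERY centre `y` (gauge to the `y`-centred potential `a(z,e₁) = i f (z₀ − y₀)·1`: `|a| ≤ |f|K` on `box K y`, first differences
`≤ |f|`, second differences `0`); `lipGauge_gaugeAct_landau` (so is every unitary gauge transform, g5 `lipGauge_gaugeAct_iff`).  §2 `regularity_torusVP_lipGauge_of_factor`
(leaf-06's `Regularity (torusVP …)` at the shape `lipGauge` from ONE admissible common factor `t < B₃·M·ε₁`; the `t = 0` case is n16-w1's `regularity_torusVP_lipGauge_of_zero`).
§3 (`[Unique n]`) ★★★ `regularity_of_isMinimiser_uniformScalar`: at an `ε₁`-loose datum of `𝒟_unif` (`|ω| ≤ 2ε₁` by Jordan), every minimiser of run `k+1` over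
`sfClass (d+2) L N (B₃ε₁) (k+1)` (`B₃ ≥ 2`, leaf-05's regime) satisfies `Regularity (torusVP (d+2) L N (lipGauge (d+2) n) (k+1)) B₃ B₄ ε₁ U (y, K)` on EVERY cube with
`L^{k+1} ≤ K` — in particular on the slot cubes `K = L^{k+1} − 1 + L^{k+1} + 2`: the admissible factor is `t = |ω|K∕L^{k+1} < B₃·(2K+1)∕(2L^{k+1})·ε₁`.  ★★★ `reg910Slot_on_uniformScalar`:
the (T9ˢ) TEXT of `stub_reg910Slot` (binder for binder, at `G := lipGauge`, every `C : B11Thm1.Consts` with `2 ≤ C.B₃` and `C.B₃·C.a₁` in leaf-05's regime) with the datum ranging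
over `sfClass (d+2) L N ε₁ 0 ∩ 𝒟_unif`; ★★★ `slotKey_bundle_on_uniformScalar`: `RadiiMono G ∧ interface G ∧ (T9ˢ)|_{𝒟_unif} ∧ (T8)|_{𝒟_unif}` at `G := lipGauge (d+2) n` — with
file 3's (T8) and file 6's uniqueness up to gauge, [Balaban1985Variational] Thm 1's THREE CLAUSES (existence in the (8)-class at a `k`-uniform radius, uniqueness of the minimal orbit,
(9)–(10)-regularity) are VERIFIED on the first non-flat data family in the rank-one model.

DEPENDENCES (by name): file 6 (`exists_central_gauge_of_isMinimiser`); file 3 (`exists8Min_on_uniformScalar`, `abs_le_two_mul_norm_cexp_smul_one_sub_one`); file 1 (the Landau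
exponents); dag-n16-w1 `…N16H7OfN07RecordSlot` (`lipGauge`, `radiiMono_lipGauge'`, `interface_lipGauge'`); this seat's g5 `…N16SlotKeyGaugeQuotient` (`lipGauge_gaugeAct_iff`);
leaf-06 `MinimalActionDictionary` (`torusVP`, `gaugeFactors`, `gaugeInf`, `cubeM`, `cubeM_pos`, `RadiiMono`); `B11.Regularity`; `T4AveragingDeficitWall` (`box`);
`T4AveragingDeficitWallBoundary` (`scalarCfg`, `exp_add_smul_one`, `smul_one_mem_unitary`); `FederbushMean` (`cexp_smul_one`, `norm_smul_one_eq`); `AveragingDeficitLatticeH2Prep.fd`;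
`NE3EnergyShapes.IsUnitarySite`; `MinimalActionSandwich.IsMinimiser`; `MinimalActionRate.sfClass`; Mathlib (`csInf_le`, `Finset.mem_Icc`, `Real.rpow_pos_of_pos`).
-/

open scoped BigOperators Matrix Matrix.Norms.L2Operator
open NormedSpace Finset

namespace Summit.QuantumFields.YangMills.BalabanUVNodes.N16UniformScalarSlotKey

open Literature.MathematicalPhysics.QuantumFieldTheory.Balaban1983to89
open B7Prop1Explicit B7Prop2Explicit MatrixLog UnitaryModel
open T4AveragingDeficitWall hiding Site Plane Plaq Bond
open T4AveragingDeficitWallBoundary (scalarCfg IsPeriodicCfg exp_add_smul_one smul_one_mem_unitary fin_zero_ne_one fin_one_ne_zero norm_real_mul_I)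
open FederbushMean (cexp_smul_one norm_smul_one_eq)
open Summit.QuantumFields.BalabanUV.T4Continuum
open AveragingDeficitLatticeH2Prep (fd)
open MinimalActionSandwich (IsMinimiser)
open MinimalActionRate (sfClass)
open MinimalActionDictionary (torusVP RadiiMono gaugeFactors gaugeInf cubeM cubeM_pos)
open NE3EnergyShapes (IsUnitarySite IsPeriodicSite)
open B11 (Regularity)
open Summit.QuantumFields.YangMills.BalabanUVNodes.N16H7OfN07RecordSlot (lipGauge radiiMono_lipGauge' interface_lipGauge')
open Summit.QuantumFields.YangMills.BalabanUVNodes.N16SlotKeyGaugeQuotient (lipGauge_gaugeAct_iff)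
open Summit.QuantumFields.YangMills.BalabanUVNodes.N16Exists8UniformScalar (exists8Min_on_uniformScalar abs_le_two_mul_norm_cexp_smul_one_sub_one)
open Summit.QuantumFields.YangMills.BalabanUVNodes.N16UniformScalarMinimisers (exists_central_gauge_of_isMinimiser)

noncomputable section

variable {d : ℕ} {n : Type} [Fintype n] [DecidableEq n]

/-! ## §1 The Landau field is in the (9)_{β₀=1} sup shape about every centre -/

/-- On `box K y` the `0`-th coordinate differs from `y₀` by at most `K`. [folklore] -/
theorem abs_sub_le_of_mem_box {K : ℕ} {y z : B7Prop1Explicit.Site (d + 2)} (hz : z ∈ box K y) : |((z 0 : ℤ) : ℝ) - ((y 0 : ℤ) : ℝ)| ≤ (K : ℝ) := by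
  obtain ⟨h1, h2⟩ := Finset.mem_Icc.mp hz
  have h1' := h1 0
  have h2' := h2 0
  simp only [Pi.sub_apply, Pi.add_apply] at h1' h2'
  rw [abs_le]
  constructor
  · have : ((y 0 : ℤ) : ℝ) - (K : ℝ) ≤ ((z 0 : ℤ) : ℝ) := by exact_mod_cast h1'
    linarith
  · have : ((z 0 : ℤ) : ℝ) ≤ ((y 0 : ℤ) : ℝ) + (K : ℝ) := by exact_mod_cast h2'
    linarith

/-- **★ THE LANDAU FIELD IS IN THE (9)_{β₀=1} SUP SHAPE ABOUT EVERY CENTRE**: `lipGauge (d+2) n U_{f,0,0} y K (|f|·K) |f| 0` — gauge `U_{f,0,0}` to the `y`-centred potential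
`a(z, e₁) = i f (z₀ − y₀)·1` (a scalar gauge `e^{i f y₀ z₁}·1`); on `box K y`: `‖a‖ ≤ |f|K`, `‖∇_i a‖ ≤ |f|` (only `i = 0` moves it), `∇∇a = 0`. [folklore] -/
theorem lipGauge_landau [Nonempty n] (f : ℝ) (y : B7Prop1Explicit.Site (d + 2)) (K : ℕ) :
    lipGauge (d + 2) n (scalarCfg (n := n) (fun (x : B7Prop1Explicit.Site (d + 2)) (κ : Fin (d + 2)) =>
      ((if κ = 1 then f * ((x 0 : ℤ) : ℝ) + 0 else if κ = 0 then (0 : ℝ) else 0 : ℝ) : ℂ) * Complex.I)) y K (|f| * K) |f| 0 := by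
  -- the centring gauge `g(z) = e^{i f y₀ z₁}·1` and the centred potential
  refine ⟨fun z => expUnit ((((f * ((y 0 : ℤ) : ℝ) * ((z 1 : ℤ) : ℝ) : ℝ) : ℂ) * Complex.I) • (1 : Matrix n n ℂ)),
    fun z τ => (((if τ = 1 then f * (((z 0 : ℤ) : ℝ) - ((y 0 : ℤ) : ℝ)) else 0 : ℝ) : ℂ) * Complex.I) • (1 : Matrix n n ℂ),
    fun z => ?_, fun z τ _ => ?_, fun z τ hz => ?_, fun z τ i hz => ?_, fun z τ i l _ => ?_⟩
  · -- unitary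
    rw [mem_unitaryUnits, val_expUnit, ← cexp_smul_one]
    exact smul_one_mem_unitary (Complex.norm_exp_ofReal_mul_I _)
  · -- the gauged bond variable is `exp` of the centred potential
    simp only [gaugeAct, scalarCfg, Units.val_mul, val_expUnit, val_inv_expUnit, ← neg_smul]
    rw [← exp_add_smul_one, ← exp_add_smul_one]
    congr 2
    have h1 : (((z + e τ) 1 : ℤ) : ℝ) = ((z 1 : ℤ) : ℝ) + if (1 : Fin (d + 2)) = τ then 1 else 0 := by
      rw [Pi.add_apply, e_apply]; push_cast; rfl
    rw [h1]
    by_cases hτ1 : τ = 1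
    · subst hτ1
      simp only [if_true]; push_cast; ring
    · simp only [hτ1, Ne.symm hτ1, if_false]
      by_cases hτ0 : τ = 0
      · simp only [hτ0, if_true]; push_cast; ring
      · simp only [hτ0, if_false]; push_cast; ring
  · -- `‖a‖ ≤ |f| K`
    by_cases hτ1 : τ = 1
    · simp only [hτ1, if_true]
      rw [norm_smul_one_eq, norm_real_mul_I, abs_mul]
      exact mul_le_mul_of_nonneg_left (abs_sub_le_of_mem_box hz) (abs_nonneg f)
    · simp only [hτ1, if_false]
      rw [norm_smul_one_eq, norm_real_mul_I, abs_zero]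
      positivity
  · -- first differences `≤ |f|`
    unfold fd
    have h0 : (((z + e i) 0 : ℤ) : ℝ) = ((z 0 : ℤ) : ℝ) + if (0 : Fin (d + 2)) = i then 1 else 0 := by
      rw [Pi.add_apply, e_apply]; push_cast; rfl
    rw [← sub_smul, ← sub_mul, norm_smul_one_eq, ← Complex.ofReal_sub, norm_real_mul_I, h0]
    by_cases hτ1 : τ = 1
    · simp only [hτ1, if_true]
      by_cases hi : (0 : Fin (d + 2)) = i
      · rw [if_pos hi, show f * (((z 0 : ℤ) : ℝ) + 1 - ((y 0 : ℤ) : ℝ)) - f * (((z 0 : ℤ) : ℝ) - ((y 0 : ℤ) : ℝ)) = f by ring]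
      · rw [if_neg hi, show f * (((z 0 : ℤ) : ℝ) + 0 - ((y 0 : ℤ) : ℝ)) - f * (((z 0 : ℤ) : ℝ) - ((y 0 : ℤ) : ℝ)) = 0 by ring, abs_zero]
        exact abs_nonneg f
    · simp only [hτ1, if_false, sub_self, abs_zero]
      exact abs_nonneg f
  · -- second differences vanish (the potential is affine in `z₀`)
    unfold fd
    have h0 : ∀ (w : B7Prop1Explicit.Site (d + 2)) (ι : Fin (d + 2)), (((w + e ι) 0 : ℤ) : ℝ) = ((w 0 : ℤ) : ℝ) + if (0 : Fin (d + 2)) = ι then 1 else 0 := by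
      intro w ι; rw [Pi.add_apply, e_apply]; push_cast; rfl
    rw [← sub_smul, ← sub_smul, ← sub_smul, norm_smul_one_eq]
    rw [h0 (z + e i) l, h0 z i, h0 z l]
    refine le_of_eq ?_
    rw [norm_eq_zero]
    split_ifs <;> push_cast <;> ring

/-- … hence so is every CENTRAL (indeed every) unitary gauge transform of it (this seat's g5 `lipGauge_gaugeAct_iff`). [folklore] -/
theorem lipGauge_gaugeAct_landau [Nonempty n] (f : ℝ) {u : B7Prop1Explicit.Site (d + 2) → (Matrix n n ℂ)ˣ} (hu : IsUnitarySite u)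
    (y : B7Prop1Explicit.Site (d + 2)) (K : ℕ) :
    lipGauge (d + 2) n (gaugeAct u (scalarCfg (n := n) (fun (x : B7Prop1Explicit.Site (d + 2)) (κ : Fin (d + 2)) =>
      ((if κ = 1 then f * ((x 0 : ℤ) : ℝ) + 0 else if κ = 0 then (0 : ℝ) else 0 : ℝ) : ℂ) * Complex.I))) y K (|f| * K) |f| 0 :=
  (lipGauge_gaugeAct_iff hu _ y K _ _ _).mpr (lipGauge_landau f y K)

/-! ## §2 Leaf-06's `Regularity` at the shape `lipGauge` from one admissible common factor -/

/-- **`Regularity (torusVP d L N lipGauge k)` FROM ONE ADMISSIBLE FACTOR**: if `lipGauge d n U y K (t∕L^k) (t∕L^{2k}) (t∕L^{3k})` with `0 ≤ t < B₃·M·ε₁` (`M = cubeM L k K`),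
`B₄, ε₁ > 0`, `L ≥ 1`, then `B11.Regularity (torusVP d L N (lipGauge d n) k) B₃ B₄ ε₁ U (y, K)` (the infimum `Ψ ≤ t`; the Hölder clause is `0 < B₄Mε₁`). [folklore] -/
theorem regularity_torusVP_lipGauge_of_factor {L N k : ℕ} (hL : 1 ≤ L) {B₃ B₄ ε₁ t : ℝ} (hB₄ : 0 < B₄) (hε₁ : 0 < ε₁) (ht0 : 0 ≤ t)
    {U : B7Prop1Explicit.Site d → Fin d → (Matrix n n ℂ)ˣ} {y : B7Prop1Explicit.Site d} {K : ℕ}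
    (h : lipGauge d n U y K (t / (L : ℝ) ^ k) (t / ((L : ℝ) ^ k) ^ 2) (t / ((L : ℝ) ^ k) ^ 3)) (htlt : t < B₃ * cubeM L k K * ε₁) :
    Regularity (torusVP d L N (lipGauge d n) k) B₃ B₄ ε₁ U (y, K) := by
  have hL0 : 0 < L := by omega
  have hLr : (0 : ℝ) < (L : ℝ) := by exact_mod_cast hL0
  have hmem : t ∈ gaugeFactors (lipGauge d n) L k U y K := ⟨ht0, h⟩
  have hinf : gaugeInf (lipGauge d n) L k U y K ≤ t := csInf_le ⟨0, fun s hs => hs.1⟩ hmem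
  have hM : 0 < cubeM L k K := cubeM_pos hL k K
  have hx : ((L : ℝ) ^ k * (((L : ℝ) ^ k)⁻¹))⁻¹ = 1 := by
    rw [mul_inv_cancel₀ (pow_ne_zero _ hLr.ne'), inv_one]
  have h9 : gaugeInf (lipGauge d n) L k U y K < B₃ * cubeM L k K * ε₁ := hinf.trans_lt htlt
  unfold Regularity
  dsimp only [torusVP]
  refine ⟨⟨t, hmem⟩, ?_, ?_, fun β _ _ => ?_, ?_⟩
  · rw [hx, one_pow, mul_one]; exact h9
  · rw [hx, one_pow, mul_one]; exact h9
  · rw [hx, Real.one_rpow, mul_one]; positivity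
  · rw [hx, one_pow, mul_one]; exact h9

/-! ## §3 (T9ˢ) on the uniform-curvature scalar data, at rank one -/

section RankOne

variable [Unique n] {L N : ℕ}

/-- **★★★ EVERY MINIMISER AT A UNIFORM-CURVATURE DATUM IS (9)–(10)-REGULAR ON EVERY LARGE CUBE** (rank one; `L ≥ 2`, `N ≥ 1`, leaf-05's regime for the class radius `B₃ε₁`,
`B₃ ≥ 2`, `B₄ > 0`): for an `N`-periodic scalar datum of uniform `(e₀,e₁)`-curvature `ω` with `|ω| ≤ 2ε₁` and `|ω| ≤ 1∕2`, every minimiser `U` of run `k+1` over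
`sfClass (d+2) L N (B₃ε₁) (k+1)` and every cube `(y, K)` with `L^{k+1} ≤ K`: `Regularity (torusVP (d+2) L N (lipGauge (d+2) n) (k+1)) B₃ B₄ ε₁ U (y, K)` (the minimiser is a
central gauge transform of the Landau field `f = ω∕L^{2(k+1)}`, file 6; admissible factor `t = |ω|K∕L^{k+1} < B₃(2K+1)ε₁∕(2L^{k+1})`). [cite: Balaban1985Variational, Thm 1 (9)–(10) p.279] -/
theorem regularity_of_isMinimiser_uniformScalar (hL : 2 ≤ L) (hN : 1 ≤ N) {B₃ B₄ ε₁ : ℝ} (hB₃ : 2 ≤ B₃) (hB₄ : 0 < B₄) (hε₁ : 0 < ε₁)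
    (he1 : 16 * C0 (d + 2) * (B₃ * ε₁) ≤ 3) (he2 : 1024 * ((d + 2 : ℕ) + 1 : ℝ) * ((d + 2 : ℕ) + 4) * (L : ℝ) ^ 2 * (B₃ * ε₁) ≤ 1)
    {ω : ℝ} (hωε : |ω| ≤ 2 * ε₁) (hω : |ω| ≤ 1 / 2) {G : B7Prop1Explicit.Site (d + 2) → Fin (d + 2) → ℝ}
    (hP : IsPeriodicCfg (scalarCfg (n := n) (fun y ν => ((G y ν : ℝ) : ℂ) * Complex.I)) (N : ℤ))
    (hcurv : ∀ (x : B7Prop1Explicit.Site (d + 2)) (κ μ : Fin (d + 2)), κ ≠ μ →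
      hol (scalarCfg (n := n) (fun y ν => ((G y ν : ℝ) : ℂ) * Complex.I)) x (plaqWord κ μ)
        = expUnit ((((if κ = 0 ∧ μ = 1 then ω else if κ = 1 ∧ μ = 0 then -ω else 0 : ℝ) : ℂ) * Complex.I) • (1 : Matrix n n ℂ)))
    (k : ℕ) {U : B7Prop1Explicit.Site (d + 2) → Fin (d + 2) → (Matrix n n ℂ)ˣ}
    (hmin : IsMinimiser (d + 2) (sfClass (d + 2) L N (B₃ * ε₁)) L N (k + 1) (scalarCfg (n := n) (fun y ν => ((G y ν : ℝ) : ℂ) * Complex.I)) U)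
    (y : B7Prop1Explicit.Site (d + 2)) {K : ℕ} (hK : L ^ (k + 1) ≤ K) :
    Regularity (torusVP (d + 2) L N (lipGauge (d + 2) n) (k + 1)) B₃ B₄ ε₁ U (y, K) := by
  have hL1 : 1 ≤ L := by omega
  have hB0 : 0 < B₃ := by linarith
  have hωe : |ω| ≤ B₃ * ε₁ := hωε.trans (by nlinarith)
  obtain ⟨u, hu, -, hU⟩ := exists_central_gauge_of_isMinimiser (n := n) (k := k + 1) hL hN (by positivity) he1 he2 hωe hω hP hcurv hmin
  set f : ℝ := ω / (L : ℝ) ^ (2 * (k + 1)) with hf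
  -- the Landau field (and its gauge transform `U`) is in `lipGauge` about `y` with radii `(|f|K, |f|, 0)`
  have hlip : lipGauge (d + 2) n U y K (|f| * K) |f| 0 := by rw [hU]; exact lipGauge_gaugeAct_landau (n := n) f hu y K
  -- the admissible factor `t = |ω|·K∕L^{k+1}` (`= |f|·K·L^{k+1}`)
  have hLk : (0 : ℝ) < (L : ℝ) ^ (k + 1) := by positivity
  have hKr : (L : ℝ) ^ (k + 1) ≤ (K : ℝ) := by exact_mod_cast hK
  have hK0 : (0 : ℝ) ≤ K := by positivity
  have habsf : |f| = |ω| / ((L : ℝ) ^ (k + 1)) ^ 2 := by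
    rw [hf, abs_div, mul_comm 2 (k + 1), pow_mul, abs_of_pos (by positivity : (0 : ℝ) < ((L : ℝ) ^ (k + 1)) ^ 2)]
  set t : ℝ := |ω| * (K : ℝ) / (L : ℝ) ^ (k + 1) with ht
  have ht0 : 0 ≤ t := by positivity
  have h0 : |f| * K ≤ t / (L : ℝ) ^ (k + 1) := le_of_eq (by rw [habsf, ht]; ring)
  have h1 : |f| ≤ t / ((L : ℝ) ^ (k + 1)) ^ 2 := by
    have hKA : 1 ≤ (K : ℝ) / (L : ℝ) ^ (k + 1) := by rw [le_div_iff₀ hLk]; linarith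
    calc |f| = |ω| / ((L : ℝ) ^ (k + 1)) ^ 2 * 1 := by rw [habsf, mul_one]
      _ ≤ |ω| / ((L : ℝ) ^ (k + 1)) ^ 2 * ((K : ℝ) / (L : ℝ) ^ (k + 1)) := mul_le_mul_of_nonneg_left hKA (by positivity)
      _ = t / ((L : ℝ) ^ (k + 1)) ^ 2 := by rw [ht]; ring
  have h2 : (0 : ℝ) ≤ t / ((L : ℝ) ^ (k + 1)) ^ 3 := by positivity
  have hlip' := radiiMono_lipGauge' U y K _ _ _ _ _ _ h0 h1 h2 hlip
  refine regularity_torusVP_lipGauge_of_factor (n := n) hL1 hB₄ hε₁ ht0 hlip' ?_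
  -- `|ω| K / L^{k+1} < B₃ (2K+1)/(2L^{k+1}) ε₁`
  rw [ht, cubeM, show B₃ * ((2 * (K : ℝ) + 1) / (2 * (L : ℝ) ^ (k + 1))) * ε₁ = (B₃ * ε₁ * (2 * K + 1) / 2) / (L : ℝ) ^ (k + 1) by ring,
    div_lt_div_iff_of_pos_right hLk]
  have hBe : 0 < B₃ * ε₁ := by positivity
  nlinarith [mul_le_mul_of_nonneg_right hωe hK0]

/-- **★★★ THE (T9ˢ) TEXT OF `stub_reg910Slot` ON `𝒟_unif`, AT RANK ONE** (binder for binder at `G := lipGauge (d+2) n`; every `C : B11Thm1.Consts` with `2 ≤ C.B₃` and `C.B₃·C.a₁` in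
leaf-05's regime): for every run `k+1`, every `0 < ε₁ ≤ C.a₁`, every `ε₁`-loose datum in `𝒟_unif` and every minimiser `U` over `sfClass (d+2) L N (C.B₃ε₁) (k+1)`: `Regularity` on
the slot cube `(x, L^{k+1} − 1 + L^{k+1} + 2)` about EVERY site. [cite: Balaban1985Variational, Thm 1 (9)–(10) p.279] -/
theorem reg910Slot_on_uniformScalar (hL : 2 ≤ L) (hN : 1 ≤ N) (C : B11Thm1.Consts) (hB : 2 ≤ C.B₃)
    (hr1 : 16 * C0 (d + 2) * (C.B₃ * C.a₁) ≤ 3) (hr2 : 1024 * ((d + 2 : ℕ) + 1 : ℝ) * ((d + 2 : ℕ) + 4) * (L : ℝ) ^ 2 * (C.B₃ * C.a₁) ≤ 1) (hr3 : C.B₃ * C.a₁ ≤ 1 / 2) :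
    ∀ (k : ℕ) (ε₁ : ℝ), 0 < ε₁ → ε₁ ≤ C.a₁ → ∀ V U : B7Prop1Explicit.Site (d + 2) → Fin (d + 2) → (Matrix n n ℂ)ˣ, V ∈ sfClass (d + 2) L N ε₁ 0 →
      V ∈ {V | ∃ (G : B7Prop1Explicit.Site (d + 2) → Fin (d + 2) → ℝ) (ω : ℝ), |ω| ≤ 1 ∧ V = scalarCfg (n := n) (fun x κ => ((G x κ : ℝ) : ℂ) * Complex.I) ∧
        ∀ (x : B7Prop1Explicit.Site (d + 2)) (κ μ : Fin (d + 2)), κ ≠ μ → hol V x (plaqWord κ μ)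
          = expUnit ((((if κ = 0 ∧ μ = 1 then ω else if κ = 1 ∧ μ = 0 then -ω else 0 : ℝ) : ℂ) * Complex.I) • (1 : Matrix n n ℂ))} →
      IsMinimiser (d + 2) (sfClass (d + 2) L N (C.B₃ * ε₁)) L N (k + 1) V U →
        ∀ x : B7Prop1Explicit.Site (d + 2), Regularity (torusVP (d + 2) L N (lipGauge (d + 2) n) (k + 1)) C.B₃ C.B₄ ε₁ U (x, L ^ (k + 1) - 1 + L ^ (k + 1) + 2) := by
  intro k ε₁ hε₁ hε₁a V U hV hD hmin x
  obtain ⟨G, ω, hω1, rfl, hcurv⟩ := hD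
  have hB0 : 0 < C.B₃ := C.B₃_pos
  have hsmall := hV.2.2 0 0 1 fin_zero_ne_one
  rw [hcurv 0 0 1 fin_zero_ne_one, val_expUnit, ← cexp_smul_one, pow_zero, one_pow, div_one] at hsmall
  simp only [true_and, if_true] at hsmall
  have hωε : |ω| ≤ 2 * ε₁ :=
    (abs_le_two_mul_norm_cexp_smul_one_sub_one (hω1.trans (by have := Real.pi_gt_three; linarith))).trans (by linarith)
  have hε : C.B₃ * ε₁ ≤ C.B₃ * C.a₁ := mul_le_mul_of_nonneg_left hε₁a hB0.le
  have hωhalf : |ω| ≤ 1 / 2 := by nlinarith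
  have hPer : IsPeriodicCfg (scalarCfg (n := n) (fun x κ => ((G x κ : ℝ) : ℂ) * Complex.I)) (N : ℤ) := by simpa using hV.2.1
  refine regularity_of_isMinimiser_uniformScalar (n := n) hL hN hB C.B₄_pos hε₁ ?_ ?_ hωε hωhalf hPer hcurv k hmin x (by omega)
  · exact (mul_le_mul_of_nonneg_left hε (by have := C0_pos (d + 2); positivity)).trans hr1
  · exact (mul_le_mul_of_nonneg_left hε (by positivity)).trans hr2

/-- **★★★ THE SLOT-KEY BUNDLE ON `𝒟_unif`, AT RANK ONE**: with `G := lipGauge (d+2) n` and every `C : B11Thm1.Consts` as above — `RadiiMono G`, the (9)_{β₀=1} interface on cubes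
`K ≥ 2`, the (T9ˢ) text and the (T8) text, both with the datum ranging over `sfClass (d+2) L N ε₁ 0 ∩ 𝒟_unif` (dag-n16-e's ∕ this seat's DischargeTest `stub_reg910Slot` SHAPE
restricted to the uniform-curvature scalar data; the unrestricted stub is node N07's content and is NOT touched). [cite: Balaban1985Variational, Thm 1 (8)–(10) p.279] -/
theorem slotKey_bundle_on_uniformScalar (hL : 2 ≤ L) (hN : 1 ≤ N) (C : B11Thm1.Consts) (hB : 2 ≤ C.B₃)
    (hr1 : 16 * C0 (d + 2) * (C.B₃ * C.a₁) ≤ 3) (hr2 : 1024 * ((d + 2 : ℕ) + 1 : ℝ) * ((d + 2 : ℕ) + 4) * (L : ℝ) ^ 2 * (C.B₃ * C.a₁) ≤ 1) (hr3 : C.B₃ * C.a₁ ≤ 1 / 2) :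
    RadiiMono (d + 2) (lipGauge (d + 2) n) ∧
    (∀ (U : B7Prop1Explicit.Site (d + 2) → Fin (d + 2) → (Matrix n n ℂ)ˣ) (x : B7Prop1Explicit.Site (d + 2)) (K : ℕ) (α₀ α₁ α₂ : ℝ), 2 ≤ K →
      lipGauge (d + 2) n U x K α₀ α₁ α₂ →
      ∃ (u : B7Prop1Explicit.Site (d + 2) → (Matrix n n ℂ)ˣ) (a : B7Prop1Explicit.Site (d + 2) → Fin (d + 2) → Matrix n n ℂ),
        (∀ z, u z ∈ unitaryUnits (Matrix n n ℂ)) ∧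
        (∀ (y : B7Prop1Explicit.Site (d + 2)) (τ : Fin (d + 2)), l1 (y - x) ≤ 2 → ((gaugeAct u U y τ : (Matrix n n ℂ)ˣ) : Matrix n n ℂ) = exp (a y τ)) ∧
        (∀ (y : B7Prop1Explicit.Site (d + 2)) (τ : Fin (d + 2)), l1 (y - x) ≤ 2 → ‖a y τ‖ ≤ α₀) ∧
        (∀ (y : B7Prop1Explicit.Site (d + 2)) (τ i : Fin (d + 2)), l1 (y - x) ≤ 1 → ‖fd i (fun z => a z τ) y‖ ≤ α₁) ∧
        (∀ (τ i l : Fin (d + 2)), ‖fd i (fd l (fun z => a z τ)) x‖ ≤ α₂)) ∧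
    (∀ (k : ℕ) (ε₁ : ℝ), 0 < ε₁ → ε₁ ≤ C.a₁ → ∀ V U : B7Prop1Explicit.Site (d + 2) → Fin (d + 2) → (Matrix n n ℂ)ˣ, V ∈ sfClass (d + 2) L N ε₁ 0 →
      V ∈ {V | ∃ (G : B7Prop1Explicit.Site (d + 2) → Fin (d + 2) → ℝ) (ω : ℝ), |ω| ≤ 1 ∧ V = scalarCfg (n := n) (fun x κ => ((G x κ : ℝ) : ℂ) * Complex.I) ∧
        ∀ (x : B7Prop1Explicit.Site (d + 2)) (κ μ : Fin (d + 2)), κ ≠ μ → hol V x (plaqWord κ μ)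
          = expUnit ((((if κ = 0 ∧ μ = 1 then ω else if κ = 1 ∧ μ = 0 then -ω else 0 : ℝ) : ℂ) * Complex.I) • (1 : Matrix n n ℂ))} →
      IsMinimiser (d + 2) (sfClass (d + 2) L N (C.B₃ * ε₁)) L N (k + 1) V U →
        ∀ x : B7Prop1Explicit.Site (d + 2), Regularity (torusVP (d + 2) L N (lipGauge (d + 2) n) (k + 1)) C.B₃ C.B₄ ε₁ U (x, L ^ (k + 1) - 1 + L ^ (k + 1) + 2)) ∧
    (∀ (k : ℕ) (ε₁ : ℝ), 0 < ε₁ → ε₁ ≤ C.a₁ → ∀ V : B7Prop1Explicit.Site (d + 2) → Fin (d + 2) → (Matrix n n ℂ)ˣ, V ∈ sfClass (d + 2) L N ε₁ 0 →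
      V ∈ {V | ∃ (G : B7Prop1Explicit.Site (d + 2) → Fin (d + 2) → ℝ) (ω : ℝ), |ω| ≤ 1 ∧ V = scalarCfg (n := n) (fun x κ => ((G x κ : ℝ) : ℂ) * Complex.I) ∧
        ∀ (x : B7Prop1Explicit.Site (d + 2)) (κ μ : Fin (d + 2)), κ ≠ μ → hol V x (plaqWord κ μ)
          = expUnit ((((if κ = 0 ∧ μ = 1 then ω else if κ = 1 ∧ μ = 0 then -ω else 0 : ℝ) : ℂ) * Complex.I) • (1 : Matrix n n ℂ))} →
      ∃ U : B7Prop1Explicit.Site (d + 2) → Fin (d + 2) → (Matrix n n ℂ)ˣ, IsMinimiser (d + 2) (sfClass (d + 2) L N (C.B₃ * ε₁)) L N (k + 1) V U) :=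
  ⟨radiiMono_lipGauge', fun U x K α₀ α₁ α₂ hK h => interface_lipGauge' U x K α₀ α₁ α₂ hK h,
    reg910Slot_on_uniformScalar (n := n) hL hN C hB hr1 hr2 hr3, exists8Min_on_uniformScalar (n := n) hL hN C hB hr1 hr2 hr3⟩

end RankOne

end

end Summit.QuantumFields.YangMills.BalabanUVNodes.N16UniformScalarSlotKey
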